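import Summits.Ventures.HSemireg.Mod4SiteMiddleSpan
import Summits.Ventures.HSemireg.Mod4SiteMixedMiddle

/-!
# Venture HSemireg — MOD-4 line: THEOREM R_f's MIDDLE-DEGREE CLAUSE in th-7's Weil model, every `n ≥ 1`, every `q`, `ab ≠ 0`
# (`R_n + 2·r_n + dim ker(M_f(q̃) − ab) = (r_n + 2)·C(2n,n)`)

HONEST FRAMING. Part of the Lean index of the computation cell `pub-hsemireg` (widening group W3, seat w3-mod4-1 gen 5; files of
record `HOME/widen/W3/MOD4-OFFSPLIT-w3mod4.md` §10.2 / §11, `MOD4-THEOREM-RF-PROOF-w3mod4.md` v1.0 §4).  Finite-dimensional exterior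
algebra over a field ONLY (th-7's sign-free transposed wedge model, tree files `Wedge*.lean`): no abelian variety, no sheaf, no Ext
group, no semiregularity map; nothing here says that HC, HC_CM or HC_AV holds; no Literature fact is declared or used.  WHAT IS PROVED
(**the middle-degree clause of THEOREM R_f in the model**, `middle_degree_rank`): in th-7's Weil model of type `(n,n)` (`N = n + n`
pairs, `v = Wedge.Weil.vW K (n+n) n q a b = w_{2n}(q) + a·E_{Gm} + b·E_{Dm}`), for every field `K`, every `n ≥ 1`, every
coefficient sequence `q : ℕ → K` and `a, b ≠ 0`:
  **`rank(θ ↦ θ ∧ v ∣ ⋀ⁿ) + 2·r_n + dim ker(M_f(q̃) − ab) = (r_n + 2)·C(2n,n)`**,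
`r_n = rank H_n(q)` (th-7's `hankel1`), `M_f(q̃) = Mod4.middleM n q̃` (seat g4's middle-degree matrix at `q̃_i = (−1)^i q_i`, the
model's sign convention; `M_f(q̃) = S·M_f(q)·S`, `S = diag(−1)^a`, has the same kernel dimensions as `M_f(q)`) — i.e. the proof sheet's
`R_n = (r_n + 2)C(2n,n) − 2r_n − dim ker(M_f − αβ)`.  ASSEMBLY (proof sheet §3′/§4): `⋀ⁿ = Mm ⊔ pairD ⊔ pairG ⊔ (selD ⊔ selG)`
(`Mod4SiteMiddleSpan.Hom_middle_eq_sup`); images: mixed part `(C(2n,n) − 2)·r_n` (`Mod4SiteMixedMiddle`), tags `C(2n,n) − 2ⁿ` twice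
(`Mod4SiteTags`, `Mod4SiteTagsG`), coupled block `2^{n+1} − dim ker` (`Mod4SiteMiddleModelU.finrank_span_words_mul_vW`); the four
images sit in spans of pairwise disjoint families of basis monomials (support predicates `Ra` = «doubled pairs = a mixed `n`-set»,
tags `t ∪ Gm` / `t ∪ Dm`, `t_B ∪ Gm` / `Dm ∪ t′_{B′}`), so their dimensions add (th-7's `Sp_inf_Sp_eq_bot`).  The side degrees are
th-7's `weilRank_nn_deg`; together this is TABLE R in closed form for every h-part in the model.  The sign pin `αβ = (−1)ⁿτ` of the
geometric dictionary (MOD4-OFFSPLIT §10.1) is not a model statement and stays with the dictionary.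
All statements and proofs: w3-mod4-1 g5 (2026-08-23).  Namespace `Summit.Ventures.HSemireg.Mod4Site`.
-/

namespace Summit.Ventures.HSemireg.Mod4Site

open ExteriorAlgebra Summit.Ventures.HSemireg.Wedge Summit.Ventures.HSemireg.Wedge.Hankel Summit.Ventures.HSemireg.Wedge.Weil
open Summit.Ventures.HSemireg.Wedge.WeilPurity (r r_ne_zero)
open Summit.Ventures.HSemireg.Mod4

variable {K : Type*} [Field K] {n : ℕ}

/-! ### §1 Dimensions add over disjoint monomial supports -/

section Sums

variable {I : Type*} [LinearOrder I] [Fintype I]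

/-- submodules inside spans of disjoint monomial families add their dimensions. -/
lemma finrank_sup_of_Sp {X Y : Submodule K (HT K I)} {P Q : Finset I → Prop} (hX : X ≤ Sp K P) (hY : Y ≤ Sp K Q)
    (hPQ : ∀ s, P s → ¬ Q s) : Module.finrank K ↥(X ⊔ Y) = Module.finrank K X + Module.finrank K Y := by
  have h := Submodule.finrank_sup_add_finrank_inf_eq X Y
  have hb : X ⊓ Y = ⊥ := eq_bot_iff.mpr (le_trans (inf_le_inf hX hY) (Sp_inf_Sp_eq_bot hPQ).le)
  rw [hb, finrank_bot, add_zero] at h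
  exact h

/-- a sup of supported submodules is supported on the disjunction. -/
lemma sup_le_Sp_or {X Y : Submodule K (HT K I)} {P Q : Finset I → Prop} (hX : X ≤ Sp K P) (hY : Y ≤ Sp K Q) :
    X ⊔ Y ≤ Sp K (fun s => P s ∨ Q s) := by
  rw [Sp_or]; exact sup_le_sup hX hY

end Sums

/-! ### §2 Two finite-set facts -/

/-- cancelling a disjoint block from a union. -/
lemma eq_of_union_eq_union {α : Type*} [DecidableEq α] {t t' G : Finset α} (ht : Disjoint t G) (ht' : Disjoint t' G)
    (h : t ∪ G = t' ∪ G) : t = t' := by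
  ext x
  constructor
  · intro hx
    have hx' : x ∈ t' ∪ G := h ▸ Finset.mem_union_left _ hx
    rcases Finset.mem_union.mp hx' with h' | h'
    · exact h'
    · exact (Finset.disjoint_left.mp ht hx h').elim
  · intro hx
    have hx' : x ∈ t ∪ G := h.symm ▸ Finset.mem_union_left _ hx
    rcases Finset.mem_union.mp hx' with h' | h'
    · exact h'
    · exact (Finset.disjoint_left.mp ht' hx h').elim

/-- a block contained in `D ∪ t` with `D` disjoint from it lies in `t`. -/
lemma subset_of_subset_union {α : Type*} [DecidableEq α] {G D t : Finset α} (hGD : Disjoint G D) (h : G ⊆ D ∪ t) : G ⊆ t := by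
  intro x hx
  rcases Finset.mem_union.mp (h hx) with h' | h'
  · exact (Finset.disjoint_left.mp hGD hx h').elim
  · exact h'

/-- the same with the union written the other way. -/
lemma subset_of_subset_union' {α : Type*} [DecidableEq α] {G D t : Finset α} (hGD : Disjoint G D) (h : G ⊆ t ∪ D) :
    G ⊆ t := by
  intro x hx
  rcases Finset.mem_union.mp (h hx) with h' | h'
  · exact h'
  · exact (Finset.disjoint_left.mp hGD hx h').elim

/-! ### §3 The four supports are pairwise disjoint (`n ≥ 1`) -/

section Supports

/-- the doubled pairs of `r ⊇ Gm` include every `G`-pair. -/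
lemma filter_ge_subset_of_Qpred_of_Gm_subset {S : Finset (Fin (n + n))} {r' : Finset (In (n + n))}
    (hQ : Qpred (n + n) S r') (hG : Gm (n + n) n ⊆ r') :
    Finset.univ.filter (fun c : Fin (n + n) => n ≤ (c : ℕ)) ⊆ S := by
  intro c hc
  rw [Finset.mem_filter] at hc
  have hx : xJ (n + n) c ∈ r' := hG ((mem_Gm_iff _).mpr (by rw [pr_xJ]; exact hc.2))
  have hy : pt (xJ (n + n) c) ∈ r' := by rw [pt_xJ]; exact hG ((mem_Gm_iff _).mpr (by rw [pr_yJ]; exact hc.2))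
  have := (hQ (xJ (n + n) c)).mp ⟨hx, hy⟩
  rwa [pr_xJ] at this

/-- the doubled pairs of `r ⊇ Dm` include every `D`-pair. -/
lemma filter_lt_subset_of_Qpred_of_Dm_subset {S : Finset (Fin (n + n))} {r' : Finset (In (n + n))}
    (hQ : Qpred (n + n) S r') (hD : Dm (n + n) n ⊆ r') :
    Finset.univ.filter (fun c : Fin (n + n) => (c : ℕ) < n) ⊆ S := by
  intro c hc
  rw [Finset.mem_filter] at hc
  have hx : xJ (n + n) c ∈ r' := hD ((mem_Dm_iff _).mpr (by rw [pr_xJ]; exact hc.2))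
  have hy : pt (xJ (n + n) c) ∈ r' := by rw [pt_xJ]; exact hD ((mem_Dm_iff _).mpr (by rw [pr_yJ]; exact hc.2))
  have := (hQ (xJ (n + n) c)).mp ⟨hx, hy⟩
  rwa [pr_xJ] at this

/-- (a) vs (c): a mixed support is not a `D`-tag. -/
lemma Ra_not_tagD {r' : Finset (In (n + n))}
    (hRa : ∃ S ∈ MXm (n + n) n n, Qpred (n + n) S r')
    (hT : ∃ t, (t ⊆ Dm (n + n) n ∧ t.card = n ∧ ∃ i ∈ t, pt i ∈ t) ∧ r' = t ∪ Gm (n + n) n) : False := by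
  classical
  obtain ⟨S, hS, hQ⟩ := hRa
  obtain ⟨t, ⟨htD, -, i, hi, hpi⟩, rfl⟩ := hT
  rw [mem_MXm] at hS
  have hsub := filter_ge_subset_of_Qpred_of_Gm_subset hQ Finset.subset_union_right
  have hpri : pr i ∈ S := (hQ i).mp ⟨Finset.mem_union_left _ hi, Finset.mem_union_left _ hpi⟩
  have hlt : ((pr i : Fin (n + n)) : ℕ) < n := (mem_Dm_iff i).mp (htD hi)
  have hnot : pr i ∉ Finset.univ.filter (fun c : Fin (n + n) => n ≤ (c : ℕ)) := by
    rw [Finset.mem_filter, not_and, not_le]; exact fun _ => hlt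
  have hcard := Finset.card_le_card (Finset.insert_subset hpri hsub)
  rw [Finset.card_insert_of_notMem hnot, card_filter_ge] at hcard
  omega

/-- (a) vs (c′): a mixed support is not a `G`-tag. -/
lemma Ra_not_tagG {r' : Finset (In (n + n))}
    (hRa : ∃ S ∈ MXm (n + n) n n, Qpred (n + n) S r')
    (hT : ∃ t, (t ⊆ Gm (n + n) n ∧ t.card = n ∧ ∃ i ∈ t, pt i ∈ t) ∧ r' = t ∪ Dm (n + n) n) : False := by
  classical
  obtain ⟨S, hS, hQ⟩ := hRa
  obtain ⟨t, ⟨htG, -, i, hi, hpi⟩, rfl⟩ := hT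
  rw [mem_MXm] at hS
  have hsub := filter_lt_subset_of_Qpred_of_Dm_subset hQ Finset.subset_union_right
  have hpri : pr i ∈ S := (hQ i).mp ⟨Finset.mem_union_left _ hi, Finset.mem_union_left _ hpi⟩
  have hge : n ≤ ((pr i : Fin (n + n)) : ℕ) := (mem_Gm_iff i).mp (htG hi)
  have hnot : pr i ∉ Finset.univ.filter (fun c : Fin (n + n) => (c : ℕ) < n) := by
    rw [Finset.mem_filter, not_and, not_lt]; exact fun _ => hge
  have hcard := Finset.card_le_card (Finset.insert_subset hpri hsub)
  rw [Finset.card_insert_of_notMem hnot, card_filter_lt] at hcard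
  omega

/-- (a) vs `U`: a mixed support is not a tag of the coupled block. -/
lemma Ra_not_U {r' : Finset (In (n + n))}
    (hRa : ∃ S ∈ MXm (n + n) n n, Qpred (n + n) S r')
    (hU : (∃ B : Finset (Fin n), r' = (Finset.univ.image fun k : Fin n =>
        if k ∈ B then yJ (n + n) (Fin.castAdd n k) else xJ (n + n) (Fin.castAdd n k)) ∪ Gm (n + n) n) ∨
      (∃ B' : Finset (Fin n), r' = Dm (n + n) n ∪ (Finset.univ.image fun k : Fin n =>
        if k ∈ B' then yJ (n + n) (Fin.natAdd n k) else xJ (n + n) (Fin.natAdd n k)))) : False := by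
  classical
  obtain ⟨S, hS, hQ⟩ := hRa
  rw [mem_MXm] at hS
  obtain ⟨hcard, ⟨a', ha', ha'lt⟩, ⟨b', hb', hb'ge⟩⟩ := hS
  rcases hU with ⟨B, rfl⟩ | ⟨B', rfl⟩
  · have hsub := filter_ge_subset_of_Qpred_of_Gm_subset hQ Finset.subset_union_right
    have heq : Finset.univ.filter (fun c : Fin (n + n) => n ≤ (c : ℕ)) = S :=
      Finset.eq_of_subset_of_card_le hsub (by rw [card_filter_ge, hcard])
    have : a' ∈ Finset.univ.filter (fun c : Fin (n + n) => n ≤ (c : ℕ)) := heq ▸ ha'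
    rw [Finset.mem_filter] at this
    omega
  · have hsub := filter_lt_subset_of_Qpred_of_Dm_subset hQ Finset.subset_union_left
    have heq : Finset.univ.filter (fun c : Fin (n + n) => (c : ℕ) < n) = S :=
      Finset.eq_of_subset_of_card_le hsub (by rw [card_filter_lt, hcard])
    have : b' ∈ Finset.univ.filter (fun c : Fin (n + n) => (c : ℕ) < n) := heq ▸ hb'
    rw [Finset.mem_filter] at this
    omega

/-- (c) vs (c′). -/
lemma tagD_not_tagG (hn : 1 ≤ n) {r' : Finset (In (n + n))}
    (hT : ∃ t, (t ⊆ Dm (n + n) n ∧ t.card = n ∧ ∃ i ∈ t, pt i ∈ t) ∧ r' = t ∪ Gm (n + n) n)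
    (hT' : ∃ t, (t ⊆ Gm (n + n) n ∧ t.card = n ∧ ∃ i ∈ t, pt i ∈ t) ∧ r' = t ∪ Dm (n + n) n) : False := by
  classical
  obtain ⟨t, ⟨-, -, -⟩, rfl⟩ := hT
  obtain ⟨t₂, ⟨-, ht₂c, -⟩, h⟩ := hT'
  have hG : Gm (n + n) n ⊆ t₂ :=
    subset_of_subset_union' (disjoint_Dm_Gm n).symm (h ▸ Finset.subset_union_right)
  have := Finset.card_le_card hG
  rw [card_Gm (by omega), ht₂c] at this
  omega

/-- (c) vs `U`. -/
lemma tagD_not_U (hn : 1 ≤ n) {r' : Finset (In (n + n))}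
    (hT : ∃ t, (t ⊆ Dm (n + n) n ∧ t.card = n ∧ ∃ i ∈ t, pt i ∈ t) ∧ r' = t ∪ Gm (n + n) n)
    (hU : (∃ B : Finset (Fin n), r' = (Finset.univ.image fun k : Fin n =>
        if k ∈ B then yJ (n + n) (Fin.castAdd n k) else xJ (n + n) (Fin.castAdd n k)) ∪ Gm (n + n) n) ∨
      (∃ B' : Finset (Fin n), r' = Dm (n + n) n ∪ (Finset.univ.image fun k : Fin n =>
        if k ∈ B' then yJ (n + n) (Fin.natAdd n k) else xJ (n + n) (Fin.natAdd n k)))) : False := by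
  classical
  obtain ⟨t, ⟨htD, -, hpair⟩, rfl⟩ := hT
  rcases hU with ⟨B, h⟩ | ⟨B', h⟩
  · have heq := eq_of_union_eq_union ((disjoint_Dm_Gm n).mono_left htD)
      ((disjoint_Dm_Gm n).mono_left (letterD_selD B).1) h
    exact (letterD_selD (n := n) B).2.2 (heq ▸ hpair)
  · have hG : Gm (n + n) n ⊆ (Finset.univ.image fun k : Fin n =>
        if k ∈ B' then yJ (n + n) (Fin.natAdd n k) else xJ (n + n) (Fin.natAdd n k)) :=
      subset_of_subset_union (disjoint_Dm_Gm n).symm (h ▸ Finset.subset_union_right)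
    have := Finset.card_le_card hG
    rw [card_Gm (by omega), (letterG_selG B').2.1] at this
    omega

/-- (c′) vs `U`. -/
lemma tagG_not_U (hn : 1 ≤ n) {r' : Finset (In (n + n))}
    (hT : ∃ t, (t ⊆ Gm (n + n) n ∧ t.card = n ∧ ∃ i ∈ t, pt i ∈ t) ∧ r' = t ∪ Dm (n + n) n)
    (hU : (∃ B : Finset (Fin n), r' = (Finset.univ.image fun k : Fin n =>
        if k ∈ B then yJ (n + n) (Fin.castAdd n k) else xJ (n + n) (Fin.castAdd n k)) ∪ Gm (n + n) n) ∨
      (∃ B' : Finset (Fin n), r' = Dm (n + n) n ∪ (Finset.univ.image fun k : Fin n =>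
        if k ∈ B' then yJ (n + n) (Fin.natAdd n k) else xJ (n + n) (Fin.natAdd n k)))) : False := by
  classical
  obtain ⟨t, ⟨htG, -, hpair⟩, rfl⟩ := hT
  rcases hU with ⟨B, h⟩ | ⟨B', h⟩
  · have hD : Dm (n + n) n ⊆ (Finset.univ.image fun k : Fin n =>
        if k ∈ B then yJ (n + n) (Fin.castAdd n k) else xJ (n + n) (Fin.castAdd n k)) :=
      subset_of_subset_union' (disjoint_Dm_Gm n) (h ▸ Finset.subset_union_right)
    have := Finset.card_le_card hD
    rw [card_Dm (by omega), (letterD_selD B).2.1] at this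
    omega
  · have h' : t ∪ Dm (n + n) n = (Finset.univ.image fun k : Fin n =>
        if k ∈ B' then yJ (n + n) (Fin.natAdd n k) else xJ (n + n) (Fin.natAdd n k)) ∪ Dm (n + n) n := by
      rw [h, Finset.union_comm]
    have heq := eq_of_union_eq_union ((disjoint_Dm_Gm n).symm.mono_left htG)
      ((disjoint_Dm_Gm n).symm.mono_left (letterG_selG B').1) h'
    exact (letterG_selG (n := n) B').2.2 (heq ▸ hpair)

end Supports

/-! ### §4 THEOREM R_f, middle degree, in the model -/

section Main

/-- the mixed image is supported on «doubled pairs = a mixed `n`-set». -/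
lemma map_vW_Mm_le_Sp (q : ℕ → K) (a b' : K) :
    (Mm K (n + n) n n).map (LinearMap.mulRight K (vW K (n + n) n q a b')) ≤
      Sp K (fun r' : Finset (In (n + n)) => ∃ S ∈ MXm (n + n) n n, Qpred (n + n) S r') := by
  rw [map_mulRight_vW_Mm, map_f_Mm_eq]
  exact iSup₂_le fun S hS => (map_f_Sel_le K S q).trans (Sp_mono fun r' hr' => ⟨S, hS, hr'⟩)

/-- `m_Q = r⁻¹·E_{Gm}`. -/
lemma pairProdQ_eq (n : ℕ) : (List.ofFn fun k : Fin n => ι K (b K (In (n + n)) (xJ (n + n) (Fin.natAdd n k))) *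
      ι K (b K (In (n + n)) (yJ (n + n) (Fin.natAdd n k)))).prod = (r K n)⁻¹ • B K (In (n + n)) (Gm (n + n) n) := by
  rw [eq_inv_smul_iff₀ (r_ne_zero K (n := n)), B_Gm_eq_smul_pairProd]
/-- `m_P = r⁻¹·E_{Dm}`. -/
lemma pairProdP_eq (n : ℕ) : (List.ofFn fun k : Fin n => ι K (b K (In (n + n)) (xJ (n + n) (Fin.castAdd n k))) *
      ι K (b K (In (n + n)) (yJ (n + n) (Fin.castAdd n k)))).prod = (r K n)⁻¹ • B K (In (n + n)) (Dm (n + n) n) := by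
  rw [eq_inv_smul_iff₀ (r_ne_zero K (n := n)), B_Dm_eq_smul_pairProd]

/-- the rows of the coupled block are supported on the tags `t_B ∪ Gm`, `Dm ∪ t′_{B′}`. -/
lemma rows_le_Sp (hn : 1 ≤ n) (q : ℕ → K) (a b' : K) :
    Submodule.span K (Set.range (Sum.elim
      (fun S : Finset (Fin n) => (List.ofFn fun k : Fin n => ι K (if k ∈ S then b K (In (n + n)) (yJ (n + n) (Fin.castAdd n k))
          else b K (In (n + n)) (xJ (n + n) (Fin.castAdd n k)))).prod * vW K (n + n) n q a b')
      (fun S' : Finset (Fin n) => (List.ofFn fun k : Fin n => ι K (if k ∈ S' then b K (In (n + n)) (yJ (n + n) (Fin.natAdd n k))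
          else b K (In (n + n)) (xJ (n + n) (Fin.natAdd n k)))).prod * vW K (n + n) n q a b'))) ≤
      Sp K (fun r' : Finset (In (n + n)) =>
        (∃ B : Finset (Fin n), r' = (Finset.univ.image fun k : Fin n =>
          if k ∈ B then yJ (n + n) (Fin.castAdd n k) else xJ (n + n) (Fin.castAdd n k)) ∪ Gm (n + n) n) ∨
        (∃ B' : Finset (Fin n), r' = Dm (n + n) n ∪ (Finset.univ.image fun k : Fin n =>
          if k ∈ B' then yJ (n + n) (Fin.natAdd n k) else xJ (n + n) (Fin.natAdd n k)))) := by
  classical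
  -- the tags lie in the support span
  have hg : ∀ S : Finset (Fin n), (List.ofFn fun k : Fin n => ι K (if k ∈ S then b K (In (n + n)) (yJ (n + n) (Fin.castAdd n k))
      else b K (In (n + n)) (xJ (n + n) (Fin.castAdd n k)))).prod *
      (List.ofFn fun k : Fin n => ι K (b K (In (n + n)) (xJ (n + n) (Fin.natAdd n k))) *
        ι K (b K (In (n + n)) (yJ (n + n) (Fin.natAdd n k)))).prod ∈
      Sp K (fun r' : Finset (In (n + n)) =>
        (∃ B : Finset (Fin n), r' = (Finset.univ.image fun k : Fin n =>
          if k ∈ B then yJ (n + n) (Fin.castAdd n k) else xJ (n + n) (Fin.castAdd n k)) ∪ Gm (n + n) n) ∨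
        (∃ B' : Finset (Fin n), r' = Dm (n + n) n ∪ (Finset.univ.image fun k : Fin n =>
          if k ∈ B' then yJ (n + n) (Fin.natAdd n k) else xJ (n + n) (Fin.natAdd n k)))) := by
    intro S
    obtain ⟨c, -, h⟩ := wordP_eq_smul_B (K := K) S
    rw [h, pairProdQ_eq, smul_mul_smul_comm, B_mul_B, smul_smul]
    exact Submodule.smul_mem _ _ (B_mem_Sp (Or.inl ⟨S, rfl⟩))
  have hf : ∀ S' : Finset (Fin n), (List.ofFn fun k : Fin n => ι K (b K (In (n + n)) (xJ (n + n) (Fin.castAdd n k))) *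
        ι K (b K (In (n + n)) (yJ (n + n) (Fin.castAdd n k)))).prod *
      (List.ofFn fun k : Fin n => ι K (if k ∈ S' then b K (In (n + n)) (yJ (n + n) (Fin.natAdd n k))
        else b K (In (n + n)) (xJ (n + n) (Fin.natAdd n k)))).prod ∈
      Sp K (fun r' : Finset (In (n + n)) =>
        (∃ B : Finset (Fin n), r' = (Finset.univ.image fun k : Fin n =>
          if k ∈ B then yJ (n + n) (Fin.castAdd n k) else xJ (n + n) (Fin.castAdd n k)) ∪ Gm (n + n) n) ∨
        (∃ B' : Finset (Fin n), r' = Dm (n + n) n ∪ (Finset.univ.image fun k : Fin n =>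
          if k ∈ B' then yJ (n + n) (Fin.natAdd n k) else xJ (n + n) (Fin.natAdd n k)))) := by
    intro S'
    obtain ⟨c, -, h⟩ := wordQ_eq_smul_B (K := K) S'
    rw [h, pairProdP_eq, smul_mul_smul_comm, B_mul_B, smul_smul]
    exact Submodule.smul_mem _ _ (B_mem_Sp (Or.inr ⟨S', rfl⟩))
  rw [Submodule.span_le]
  rintro _ ⟨i, rfl⟩
  rcases i with S | S'
  · rw [Sum.elim_inl, wordP_mul_vW hn S q a b']
    refine Submodule.add_mem _ (Submodule.smul_mem _ _ (hg S)) (Submodule.sum_mem _ fun S' _ => Submodule.smul_mem _ _ (hf S'))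
  · rw [Sum.elim_inr, wordQ_mul_vW hn S' q a b']
    refine Submodule.add_mem _ (Submodule.sum_mem _ fun S _ => Submodule.smul_mem _ _ (hg S)) (Submodule.smul_mem _ _ (hf S'))

/-- `C(2n,n) ≥ 2` for `n ≥ 1`. -/
lemma two_le_choose_middle (hn : 1 ≤ n) : 2 ≤ (n + n).choose n := by
  have h := Nat.choose_le_middle 1 (n + n)
  rw [Nat.choose_one_right, show (n + n) / 2 = n by omega] at h
  omega

/-- **THEOREM R_f, MIDDLE DEGREE, IN th-7's WEIL MODEL** (every field, every `n ≥ 1`, every `q`, `a, b ≠ 0`):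
`rank(θ ↦ θ ∧ v ∣ ⋀ⁿ) + 2·r_n + dim ker(M_f(q̃) − ab) = (r_n + 2)·C(2n,n)` with `v = vW K (n+n) n q a b`, `r_n = rank H_n(q)`,
`q̃_i = (−1)^i q_i`, `M_f = Mod4.middleM`. -/
theorem middle_degree_rank (hn : 1 ≤ n) (q : ℕ → K) {a b' : K} (ha : a ≠ 0) (hb : b' ≠ 0) :
    Module.finrank K (LinearMap.range (wedge K (n + n) n (vW K (n + n) n q a b'))) + 2 * (hankel1 K (n + n) n q).rank +
      Module.finrank K (LinearMap.ker (Matrix.toLin' (middleM n (fun i => (-1 : K) ^ i * q i)) - (a * b') • LinearMap.id)) =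
      ((hankel1 K (n + n) n q).rank + 2) * (n + n).choose n := by
  classical
  -- the decomposition of `⋀ⁿ ∧ v`
  have hU : (Sp K (fun t : Finset (In (n + n)) => t ⊆ Dm (n + n) n ∧ t.card = n ∧ ¬ ∃ i ∈ t, pt i ∈ t)).map
        (LinearMap.mulRight K (vW K (n + n) n q a b')) ⊔
      (Sp K (fun t : Finset (In (n + n)) => t ⊆ Gm (n + n) n ∧ t.card = n ∧ ¬ ∃ i ∈ t, pt i ∈ t)).map
        (LinearMap.mulRight K (vW K (n + n) n q a b')) =
      Submodule.span K (Set.range (Sum.elim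
        (fun S : Finset (Fin n) => (List.ofFn fun k : Fin n => ι K (if k ∈ S then b K (In (n + n)) (yJ (n + n) (Fin.castAdd n k))
            else b K (In (n + n)) (xJ (n + n) (Fin.castAdd n k)))).prod * vW K (n + n) n q a b')
        (fun S' : Finset (Fin n) => (List.ofFn fun k : Fin n => ι K (if k ∈ S' then b K (In (n + n)) (yJ (n + n) (Fin.natAdd n k))
            else b K (In (n + n)) (xJ (n + n) (Fin.natAdd n k)))).prod * vW K (n + n) n q a b'))) := by
    rw [← span_wordsD_eq_Sp, ← span_wordsG_eq_Sp, Submodule.map_span, Submodule.map_span, ← Set.range_comp, ← Set.range_comp,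
      ← Submodule.span_union, ← Set.Sum.elim_range]
    simp only [Function.comp_def, LinearMap.mulRight_apply]
  rw [range_wedge, Hom_middle_eq_sup, Submodule.map_sup, Submodule.map_sup, Submodule.map_sup, Submodule.map_sup, hU]
  -- dimensions add
  rw [finrank_sup_of_Sp (map_vW_Mm_le_Sp q a b')
      (sup_le_Sp_or (map_vW_Sp_pairD q ha b').le (sup_le_Sp_or (map_vW_Sp_pairG q a hb).le (rows_le_Sp hn q a b')))
      (fun r' hRa h => h.elim (Ra_not_tagD hRa) (fun h => h.elim (Ra_not_tagG hRa) (Ra_not_U hRa))),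
    finrank_sup_of_Sp (map_vW_Sp_pairD q ha b').le (sup_le_Sp_or (map_vW_Sp_pairG q a hb).le (rows_le_Sp hn q a b'))
      (fun r' hT h => h.elim (tagD_not_tagG hn hT) (tagD_not_U hn hT)),
    finrank_sup_of_Sp (map_vW_Sp_pairG q a hb).le (rows_le_Sp hn q a b') (fun r' hT h => tagG_not_U hn hT h)]
  -- the four pieces
  have hA := finrank_map_vW_Mm_middle (K := K) hn q a b'
  have hC := finrank_tags_middle (K := K) n q ha b'
  have hC' := finrank_tagsG_middle (K := K) n q a hb
  have hUf := finrank_span_words_mul_vW (K := K) hn q ha hb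
  have h2 := two_le_choose_middle hn
  have hA' : Module.finrank K ↥((Mm K (n + n) n n).map (LinearMap.mulRight K (vW K (n + n) n q a b'))) +
      2 * (hankel1 K (n + n) n q).rank = (n + n).choose n * (hankel1 K (n + n) n q).rank := by
    rw [hA, ← Nat.add_mul, Nat.sub_add_cancel h2]
  linarith [hA', hC, hC', hUf]

end Main

end Summit.Ventures.HSemireg.Mod4Site
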